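import Summits.ResolutionOfSingularities.ResolutionOfSingularities.Theorems.FrobeniusLadderFInjectiveMacaulayficationLoopGermLCureAll
import Literature.AlgebraicGeometry.Resolution.GenericFibreResolutionDatum
import Literature.AlgebraicGeometry.Resolution.BlowupsLocal
import HarnessLib

/-!
# (O-3) ★★★ THE LOOP GERM IS CURED IN ONE SINGULAR-PLANE STEP — the `k[a,b,c,d,e]`-presentation (`U_L` of `…RadTauLoopConditional`)
# (crux `FInjectiveMacaulayfication` stmt-ResolutionOfSingularities-15315, chain w45a; res-L1-w45a-plan-1 g19 RULING R19.18 (ii); seat res-L1-w45a-stub-3 g10)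

[OURS · L1 W4.5a] Support file (`--supports stmt-ResolutionOfSingularities-15315 --as helper`); unconditional; def-free; replaces the role of NO printed item;
NOT a statement of the manuscript; AI-written (AI review is weaker than expert review). Sequel of `…LoopGermLCureAll`.

`…LoopGermLCureAll.loopGerm_cure` is stated on `Spec k₀[c,d,e]/(L)`, `k₀ = k[a,b]` (the presentation in which the plane blow-up is a point blow-up). This file moves
it to the desk's / res-L1-w45a-lead-1's presentation `U_L = Spec k[X₀,…,X₄]/(L)`, `L = X4² + X0²X2X4 + X0X2² + X0X2X3² + X0X1³X2²`, centre the ideal sheaf of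
`(x̄2, x̄3, x̄4)` = the singular plane `V(c,d,e)`: ★★★ `loopGerm_cure_fin5 : ∀ (S″ : Scheme) (π : S″ ⟶ U_L), IsBlowup π (x̄2,x̄3,x̄4)~ → ∀ s, FullCl 2 (S″.presheaf.stalk s)`.
Transport: the presentation isomorphism `Ψ` (`LoopGermLCure.exists_presentationEquiv`) gives `Spec`-isomorphic bases; a blowing up followed by an isomorphism of
the base is a blowing up of the moved ideal sheaf (`IsBlowup.comp_iso`, `affineBlowup.comap_idealSheaf_specMap`), and `Ψ⁻¹` carries `(x̄2,x̄3,x̄4)` to `(c̄,d̄,ē)`.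
[folklore transport; cite: GortzWedhorn2020, Prop. 13.91; StacksProject, Tag 0804]
-/

-- single-problem summit: the doubled namespace component is forced
set_option linter.dupNamespace false

noncomputable section

open AlgebraicGeometry CategoryTheory Literature.AlgebraicGeometry.Resolution TopologicalSpace IsLocalRing MvPolynomial

namespace Summit.ResolutionOfSingularities.ResolutionOfSingularities.Theorems.FInjectiveMacaulayfication.LoopGermLCureFin5

open Summit.ResolutionOfSingularities.ResolutionOfSingularities.Theorems.FInjectiveMacaulayfication
open SliceableCentre

variable (k : Type) [Field k]

/-- `Ψ⁻¹` carries the centre `(x̄2, x̄3, x̄4) ⊂ k[X]/(L)` to `(c̄, d̄, ē) ⊂ k₀[c,d,e]/(L)`. [plumbing] -/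
theorem map_centre (F : MvPolynomial (Fin 3) (MvPolynomial (Fin 2) k)) (f : MvPolynomial (Fin 5) k)
    (Ψ : (MvPolynomial (Fin 3) (MvPolynomial (Fin 2) k) ⧸ Ideal.span {F}) ≃+* (MvPolynomial (Fin 5) k ⧸ Ideal.span {f}))
    (hΨ0 : Ψ (Ideal.Quotient.mk _ (X 0)) = Ideal.Quotient.mk _ (X 2)) (hΨ1 : Ψ (Ideal.Quotient.mk _ (X 1)) = Ideal.Quotient.mk _ (X 3))
    (hΨ2 : Ψ (Ideal.Quotient.mk _ (X 2)) = Ideal.Quotient.mk _ (X 4)) :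
    Ideal.map (Ψ.symm : (MvPolynomial (Fin 5) k ⧸ Ideal.span {f}) →+* (MvPolynomial (Fin 3) (MvPolynomial (Fin 2) k) ⧸ Ideal.span {F})) (Ideal.span ({Ideal.Quotient.mk (Ideal.span {f}) (X 2), Ideal.Quotient.mk (Ideal.span {f}) (X 3), Ideal.Quotient.mk (Ideal.span {f}) (X 4)} : Set (MvPolynomial (Fin 5) k ⧸ Ideal.span {f}))) =
      Ideal.span (Set.range fun l : Fin 3 => Ideal.Quotient.mk (Ideal.span {F}) (X l)) := by
  have hs2 : Ψ.symm (Ideal.Quotient.mk (Ideal.span {f}) (X 2)) = Ideal.Quotient.mk (Ideal.span {F}) (X 0) := by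
    rw [← hΨ0, RingEquiv.symm_apply_apply]
  have hs3 : Ψ.symm (Ideal.Quotient.mk (Ideal.span {f}) (X 3)) = Ideal.Quotient.mk (Ideal.span {F}) (X 1) := by
    rw [← hΨ1, RingEquiv.symm_apply_apply]
  have hs4 : Ψ.symm (Ideal.Quotient.mk (Ideal.span {f}) (X 4)) = Ideal.Quotient.mk (Ideal.span {F}) (X 2) := by
    rw [← hΨ2, RingEquiv.symm_apply_apply]
  rw [Ideal.map_span]
  simp only [Set.image_insert_eq, Set.image_singleton, RingHom.coe_coe, hs2, hs3, hs4]
  apply le_antisymm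
  · rw [Ideal.span_le]
    intro x hx
    simp only [Set.mem_insert_iff, Set.mem_singleton_iff] at hx
    rcases hx with rfl | rfl | rfl
    · exact Ideal.subset_span ⟨0, rfl⟩
    · exact Ideal.subset_span ⟨1, rfl⟩
    · exact Ideal.subset_span ⟨2, rfl⟩
  · rw [Ideal.span_le]
    rintro _ ⟨l, rfl⟩
    fin_cases l
    · exact Ideal.subset_span (by simp)
    · exact Ideal.subset_span (by simp)
    · exact Ideal.subset_span (by simp)

set_option maxHeartbeats 800000 in
-- one base-isomorphism transport of a blowing up
/-- ★★★ **THE LOOP GERM IS CURED IN ONE SINGULAR-PLANE STEP — `k[a,b,c,d,e]`-presentation** (R19.18 (ii) verbatim base): `U_L = Spec k[X]/(L)`,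
`L = e² + a²ce + ac² + acd² + ab³c²` (`a,…,e = X0,…,X4`, `char k = 2`), `𝓚 = (x̄2, x̄3, x̄4)~` the ideal sheaf of the singular plane `V(c,d,e)` (`LoopGermLCharts.L_mem_sq_cde`):
EVERY blowing up `π : S″ ⟶ U_L` along `𝓚` is FULL (domain, Cohen–Macaulay, F-injective) AT EVERY POINT. (`…LoopGermLCureAll.loopGerm_cure` moved along
`Spec Ψ`, `Ψ : k₀[c,d,e]/(L) ≃ k[X]/(L)`.) [OURS; cite: Fedder1983, Thm. 1.12; GortzWedhorn2020, Prop. 13.91; StacksProject, Tag 0804] -/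
theorem loopGerm_cure_fin5 [CharP k 2] (f : MvPolynomial (Fin 5) k) (hf : f = X 4 ^ 2 + X 0 ^ 2 * X 2 * X 4 + X 0 * X 2 ^ 2 + X 0 * X 2 * X 3 ^ 2 + X 0 * X 1 ^ 3 * X 2 ^ 2) :
    ∀ (S'' : Scheme.{0}) (π : S'' ⟶ Spec (.of (MvPolynomial (Fin 5) k ⧸ Ideal.span {f}))),
      IsBlowup π (affineBlowup.idealSheaf (Ideal.span ({Ideal.Quotient.mk (Ideal.span {f}) (X 2), Ideal.Quotient.mk (Ideal.span {f}) (X 3), Ideal.Quotient.mk (Ideal.span {f}) (X 4)} : Set (MvPolynomial (Fin 5) k ⧸ Ideal.span {f})))) →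
      ∀ s : S'', FullCl 2 (S''.presheaf.stalk s) := by
  classical
  intro S'' π hπ s
  obtain ⟨Ψ, hΨ0, hΨ1, hΨ2, -, -⟩ := LoopGermLCure.exists_presentationEquiv k (X 2 ^ 2 + C (X 0 ^ 2) * X 0 * X 2 + C (X 0) * X 0 ^ 2 + C (X 0) * X 0 * X 1 ^ 2 + C (X 0 * X 1 ^ 3) * X 0 ^ 2) rfl f hf
  -- `Spec Ψ : U_L ≅ Spec k₀[c,d,e]/(L)`
  let i : CommRingCat.of (MvPolynomial (Fin 3) (MvPolynomial (Fin 2) k) ⧸ Ideal.span {(X 2 ^ 2 + C (X 0 ^ 2) * X 0 * X 2 + C (X 0) * X 0 ^ 2 + C (X 0) * X 0 * X 1 ^ 2 + C (X 0 * X 1 ^ 3) * X 0 ^ 2 : MvPolynomial (Fin 3) (MvPolynomial (Fin 2) k))}) ≅ CommRingCat.of (MvPolynomial (Fin 5) k ⧸ Ideal.span {f}) :=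
    Ψ.toCommRingCatIso
  let e : Spec (.of (MvPolynomial (Fin 5) k ⧸ Ideal.span {f})) ≅ Spec (.of (MvPolynomial (Fin 3) (MvPolynomial (Fin 2) k) ⧸ Ideal.span {(X 2 ^ 2 + C (X 0 ^ 2) * X 0 * X 2 + C (X 0) * X 0 ^ 2 + C (X 0) * X 0 * X 1 ^ 2 + C (X 0 * X 1 ^ 3) * X 0 ^ 2 : MvPolynomial (Fin 3) (MvPolynomial (Fin 2) k))})) := Scheme.Spec.mapIso i.op
  have he : e.inv = Spec.map (CommRingCat.ofHom (Ψ.symm : (MvPolynomial (Fin 5) k ⧸ Ideal.span {f}) →+* (MvPolynomial (Fin 3) (MvPolynomial (Fin 2) k) ⧸ Ideal.span {(X 2 ^ 2 + C (X 0 ^ 2) * X 0 * X 2 + C (X 0) * X 0 ^ 2 + C (X 0) * X 0 * X 1 ^ 2 + C (X 0 * X 1 ^ 3) * X 0 ^ 2 : MvPolynomial (Fin 3) (MvPolynomial (Fin 2) k))}))) := rfl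
  have hcomap : (affineBlowup.idealSheaf (Ideal.span ({Ideal.Quotient.mk (Ideal.span {f}) (X 2), Ideal.Quotient.mk (Ideal.span {f}) (X 3), Ideal.Quotient.mk (Ideal.span {f}) (X 4)} : Set (MvPolynomial (Fin 5) k ⧸ Ideal.span {f})))).comap e.inv =
      affineBlowup.idealSheaf (Ideal.span (Set.range fun l : Fin 3 => Ideal.Quotient.mk (Ideal.span {(X 2 ^ 2 + C (X 0 ^ 2) * X 0 * X 2 + C (X 0) * X 0 ^ 2 + C (X 0) * X 0 * X 1 ^ 2 + C (X 0 * X 1 ^ 3) * X 0 ^ 2 : MvPolynomial (Fin 3) (MvPolynomial (Fin 2) k))}) (X l))) := by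
    rw [he, affineBlowup.comap_idealSheaf_specMap, map_centre k _ f Ψ hΨ0 hΨ1 hΨ2]
  have hπ' : IsBlowup (π ≫ e.hom) (affineBlowup.idealSheaf (Ideal.span (Set.range fun l : Fin 3 => Ideal.Quotient.mk (Ideal.span {(X 2 ^ 2 + C (X 0 ^ 2) * X 0 * X 2 + C (X 0) * X 0 ^ 2 + C (X 0) * X 0 * X 1 ^ 2 + C (X 0 * X 1 ^ 3) * X 0 ^ 2 : MvPolynomial (Fin 3) (MvPolynomial (Fin 2) k))}) (X l)))) := by
    rw [← hcomap]; exact hπ.comp_iso e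
  exact LoopGermLCureAll.loopGerm_cure k _ rfl S'' (π ≫ e.hom) hπ' s

end Summit.ResolutionOfSingularities.ResolutionOfSingularities.Theorems.FInjectiveMacaulayfication.LoopGermLCureFin5

end
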